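import Literature.GroupTheory.CombinatorialGroupTheory.PuncturedSurfaceGroupCuspBases
import Literature.GroupTheory.CombinatorialGroupTheory.PuncturedSurfaceGroupZeroFourBases
import Mathlib.GroupTheory.FreeGroup.Reduce
import HarnessLib

/-!
# A free basis of `Γ_{g,r}` containing the node loop of a two-component degeneration

Topic `Literature/GroupTheory/CombinatorialGroupTheory`; theorems only.  `Γ_{g,r} = ⟨a_i, b_i, c_j ∣
∏_i [a_i,b_i] · c_0 ⋯ c_{r−1}⟩` (abc-iut-L3-t1's `PuncturedSurfaceGroup g r`, [SemiAnbd] Example 2.10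
[cite: MochizukiSemiAnbd2006, Ex. 2.10 p.31]).  In the two-component affine degeneration of abc-iut-f-164
(`PSCTwoComponentAffineShape.lean`: components `C₀ ∪_ν C₁`, handles `i < g₀` and cusps `s ≤ j` on `C₀`,
the others on `C₁`) the loop around the node seen from `C₀` is

  `ε = (c_s ⋯ c_{r−1}) · ∏_{i<g₀} [a_i, b_i]`

(both factors as ordered `List.finRange` products padded by `1`).  This file supplies the free-group
bookkeeping that makes the two subsurface groups FREE FACTORS of `Γ_{g,r}` with respect to explicit
bases (input of `PSCSeparatingCoveringsSameVertex.lean` / `…CrossVertex.lean`):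

* ordered-product lemmas `prod_map_finRange_split` (split a `finRange` product at a threshold),
  `prod_map_finRange_ite_eq_single`, `prod_map_finRange_ite_le_peel`;
* `comm_split_mul_cusp_split_eq_one` — the relator split at `g₀` and `s`;
  `nodeLoop_rel` — **`∏_{i≥g₀}[a_i,b_i] · (c_0⋯c_{s−1}) · ε = 1`** (the relation of the second component:
  "`ε⁻¹` is the same loop seen from `C₁`"), `nodeLoop_eq_c_mul` — `ε = c_s · ((c_{s+1}⋯c_{r−1}) ∏_{i<g₀}[a_i,b_i])`;
* `exists_freeGroupBasis_elim_zero` — the `c₀`-eliminating free basis `a_i, b_i, c_1, …, c_{r−1}` of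
  `Γ_{g,r}` (`r ≥ 1`), packaged from `exists_mulEquiv_freeGroup_elim_first`;
* `exists_freeGroupBasis_update_mul` — a Nielsen move: replacing one member `b_k` of a free basis by
  `b_k · u`, `u` a word in the other members, gives a free basis (`exists_freeGroupBasis_of_lifts`);
* `exists_freeGroupBasis_nodeLoop` — **the free basis `a_i, b_i, c_1, …, c_{s−1}, ε, c_{s+1}, …, c_{r−1}`
  of `Γ_{g,r}`** (`1 ≤ s < r`): the first subsurface group `⟨a_i, b_i (i<g₀), c_j (j ≥ s)⟩` is spanned by
  members of the `c₀`-eliminating basis, the second `⟨a_i, b_i (i ≥ g₀), c_j (j<s), ε⟩` by members of this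
  one (`c_0` being recovered from `nodeLoop_rel`).

Elementary combinatorial group theory (Lyndon–Schupp I.3, Nielsen transformations); nothing here concerns
[IUTchIII].
-/

namespace Literature.GroupTheory.CombinatorialGroupTheory

/-! ### Ordered products over `List.finRange` -/

section Lists

variable {M : Type*} [Monoid M]

/-- **Splitting an ordered `finRange` product at a threshold**: `∏_i F i = (∏_{i<t} F i)·(∏_{t≤i} F i)`,
both partial products written as full products padded by `1`. [cite: LyndonSchupp2001, I.3 Prop 3.8] -/
theorem prod_map_finRange_split (n t : ℕ) (F : Fin n → M) :
    ((List.finRange n).map F).prod =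
      ((List.finRange n).map fun i : Fin n => if (i : ℕ) < t then F i else 1).prod *
        ((List.finRange n).map fun i : Fin n => if t ≤ (i : ℕ) then F i else 1).prod := by
  induction n generalizing t with
  | zero => simp [List.finRange_zero]
  | succ n ih =>
    rw [List.finRange_succ, List.map_cons, List.prod_cons, List.map_map, List.map_cons, List.prod_cons,
      List.map_map, List.map_cons, List.prod_cons, List.map_map]
    rcases Nat.eq_zero_or_pos t with rfl | ht
    · -- `t = 0`: the first product is empty
      have h1 : ((List.finRange n).map ((fun i : Fin (n + 1) => if (i : ℕ) < 0 then F i else 1) ∘ Fin.succ)).prod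
          = 1 := List.prod_eq_one fun y hy => by
        obtain ⟨i, -, rfl⟩ := List.mem_map.mp hy
        simp
      have h2 : (fun i : Fin (n + 1) => if 0 ≤ (i : ℕ) then F i else 1) ∘ Fin.succ = F ∘ Fin.succ :=
        funext fun i => by simp
      simp only [Fin.val_zero, lt_self_iff_false, if_false, le_refl, if_true, one_mul, h1, h2]
    · -- `t = t' + 1`
      obtain ⟨t', rfl⟩ : ∃ t', t = t' + 1 := ⟨t - 1, by omega⟩
      have e1 : (fun i : Fin (n + 1) => if (i : ℕ) < t' + 1 then F i else 1) ∘ Fin.succ =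
          fun i : Fin n => if (i : ℕ) < t' then (F ∘ Fin.succ) i else 1 :=
        funext fun i => by simp [Fin.val_succ]
      have e2 : (fun i : Fin (n + 1) => if t' + 1 ≤ (i : ℕ) then F i else 1) ∘ Fin.succ =
          fun i : Fin n => if t' ≤ (i : ℕ) then (F ∘ Fin.succ) i else 1 :=
        funext fun i => by simp [Fin.val_succ]
      rw [e1, e2, ih t' (F ∘ Fin.succ)]
      simp [mul_assoc]

/-- A `finRange` product with a single non-unit factor. [cite: LyndonSchupp2001, I.3 Prop 3.8] -/
theorem prod_map_finRange_ite_eq_single (n : ℕ) (j : Fin n) (F : Fin n → M) :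
    ((List.finRange n).map fun i => if i = j then F i else 1).prod = F j := by
  classical
  have key : ∀ (L : List (Fin n)), L.Nodup → j ∈ L → (L.map fun i => if i = j then F i else 1).prod = F j := by
    intro L hL hj
    induction L with
    | nil => simp at hj
    | cons hd tl ih =>
      rw [List.map_cons, List.prod_cons]
      rw [List.nodup_cons] at hL
      by_cases hhd : hd = j
      · subst hhd
        rw [if_pos rfl]
        have : (tl.map fun i => if i = hd then F i else 1).prod = 1 :=
          List.prod_eq_one fun y hy => by
            obtain ⟨i, hi, rfl⟩ := List.mem_map.mp hy
            rw [if_neg]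
            rintro rfl
            exact hL.1 hi
        rw [this, mul_one]
      · rw [if_neg hhd, one_mul]
        have hj' : j ∈ tl := by
          rcases List.mem_cons.mp hj with h | h
          · exact absurd h.symm hhd
          · exact h
        exact ih hL.2 hj'
  exact key _ (List.nodup_finRange n) (List.mem_finRange j)

/-- **Peeling the first factor off a tail product**: for `s < n`,
`∏_{s ≤ i} F i = F s · ∏_{s+1 ≤ i} F i`. [cite: LyndonSchupp2001, I.3 Prop 3.8] -/
theorem prod_map_finRange_ite_le_peel (n s : ℕ) (hs : s < n) (F : Fin n → M) :
    ((List.finRange n).map fun i : Fin n => if s ≤ (i : ℕ) then F i else 1).prod =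
      F ⟨s, hs⟩ * ((List.finRange n).map fun i : Fin n => if s + 1 ≤ (i : ℕ) then F i else 1).prod := by
  rw [prod_map_finRange_split n (s + 1) (fun i : Fin n => if s ≤ (i : ℕ) then F i else 1)]
  have e1 : (fun i : Fin n => if (i : ℕ) < s + 1 then (if s ≤ (i : ℕ) then F i else 1) else 1) =
      fun i : Fin n => if i = ⟨s, hs⟩ then F i else 1 := by
    funext i
    by_cases h : i = ⟨s, hs⟩
    · subst h; simp
    · have h' : (i : ℕ) ≠ s := fun e => h (Fin.ext e)
      rw [if_neg h]
      by_cases h1 : (i : ℕ) < s + 1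
      · rw [if_pos h1, if_neg (by omega)]
      · rw [if_neg h1]
  have e2 : (fun i : Fin n => if s + 1 ≤ (i : ℕ) then (if s ≤ (i : ℕ) then F i else 1) else 1) =
      fun i : Fin n => if s + 1 ≤ (i : ℕ) then F i else 1 := by
    funext i
    by_cases h1 : s + 1 ≤ (i : ℕ)
    · rw [if_pos h1, if_pos h1, if_pos (by omega)]
    · rw [if_neg h1, if_neg h1]
  rw [e1, e2, prod_map_finRange_ite_eq_single]

/-- Membership of a padded `finRange` product in a subgroup. [cite: LyndonSchupp2001, I.3 Prop 3.8] -/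
theorem prod_map_finRange_ite_mem {G : Type*} [Group G] (H : Subgroup G) (n : ℕ) (p : Fin n → Prop)
    [DecidablePred p] (F : Fin n → G) (hF : ∀ i, p i → F i ∈ H) :
    ((List.finRange n).map fun i => if p i then F i else 1).prod ∈ H := by
  refine Subgroup.list_prod_mem _ fun y hy => ?_
  obtain ⟨i, -, rfl⟩ := List.mem_map.mp hy
  by_cases hi : p i
  · rw [if_pos hi]; exact hF i hi
  · rw [if_neg hi]; exact H.one_mem

end Lists

/-! ### A Nielsen move on a free basis -/

section Nielsen

variable {ι G : Type*} [Group G]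

/-- Local copy of `b.lift f (b i) = f i`. [cite: LyndonSchupp2001, I.3 Prop 3.8] -/
private theorem lift_apply_basis'' {H : Type*} [Group H] (b : FreeGroupBasis ι G) (f : ι → H) (i : ι) :
    b.lift f (b i) = f i := by
  change FreeGroup.lift f (b.repr (b i)) = f i
  rw [FreeGroupBasis.repr_apply_coe, FreeGroup.lift_apply_of]

/-- A member of a free basis is not the identity. [cite: LyndonSchupp2001, I.3 Prop 3.8] -/
theorem FreeGroupBasis.apply_ne_one (b : FreeGroupBasis ι G) (i : ι) : b i ≠ 1 := by
  intro h
  have h1 : b.repr (b i) = b.repr 1 := congrArg b.repr h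
  rw [FreeGroupBasis.repr_apply_coe, map_one] at h1
  exact FreeGroup.of_ne_one i h1

/-- **Nielsen move.**  If `b` is a free basis of `G`, `k` an index and `u` a word in the OTHER members
`b_j`, `j ≠ k`, then replacing `b_k` by `b_k · u` yields a free basis.
[cite: LyndonSchupp2001, I.3 Prop 3.8] -/
theorem exists_freeGroupBasis_update_mul [DecidableEq ι] (b : FreeGroupBasis ι G) (k : ι) (u : G)
    (hu : u ∈ Subgroup.closure (b '' {j | j ≠ k})) :
    ∃ b' : FreeGroupBasis ι G, b' k = b k * u ∧ ∀ j, j ≠ k → b' j = b j := by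
  let f : ι → G := Function.update b k (b k * u)
  let g : ι → G := Function.update b k (b k * u⁻¹)
  -- both substitutions fix the words in the other members
  have hfix : ∀ (h : ι → G), (∀ j, j ≠ k → h j = b j) → b.lift h u = u := by
    intro h hh
    have heq : Set.EqOn (b.lift h) (MonoidHom.id G) (b '' {j | j ≠ k}) := by
      rintro _ ⟨j, hj, rfl⟩
      rw [lift_apply_basis'', MonoidHom.id_apply, hh j hj]
    exact MonoidHom.eqOn_closure heq hu
  have hf : ∀ j, j ≠ k → f j = b j := fun j hj => Function.update_of_ne hj _ _
  have hg : ∀ j, j ≠ k → g j = b j := fun j hj => Function.update_of_ne hj _ _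
  have hfk : f k = b k * u := Function.update_self _ _ _
  have hgk : g k = b k * u⁻¹ := Function.update_self _ _ _
  obtain ⟨b', hb'⟩ := PuncturedSurfaceGroup.exists_freeGroupBasis_of_lifts b f g
    (fun i => by
      by_cases hi : i = k
      · subst hi
        rw [hfk, map_mul, lift_apply_basis'', hgk, hfix g hg, mul_assoc, inv_mul_cancel, mul_one]
      · rw [hf i hi, lift_apply_basis'', hg i hi])
    (fun i => by
      by_cases hi : i = k
      · subst hi
        rw [hgk, map_mul, map_inv, lift_apply_basis'', hfk, hfix f hf, mul_assoc, mul_inv_cancel,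
          mul_one]
      · rw [hg i hi, lift_apply_basis'', hf i hi])
  exact ⟨b', by rw [hb', hfk], fun j hj => by rw [hb', hf j hj]⟩

end Nielsen

/-! ### The node loop of the two-component affine degeneration -/

namespace PuncturedSurfaceGroup

variable {g r : ℕ}

/-- The relator of `Γ_{g,r}` holds in `Γ_{g,r}`: `(∏_i [a_i,b_i]) · (c_0 ⋯ c_{r−1}) = 1`.
[cite: MochizukiSemiAnbd2006, Ex. 2.10 p.31] -/
theorem comm_prod_mul_cusp_prod_eq_one :
    ((List.finRange g).map fun i : Fin g =>
        a (r := r) i * b i * (a i)⁻¹ * (b i)⁻¹).prod *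
      ((List.finRange r).map fun j : Fin r => c (g := g) j).prod = 1 := by
  have h1 := PresentedGroup.one_of_mem (rels := ({relator g r} : Set _)) (Set.mem_singleton (relator g r))
  rw [relator, map_mul, map_list_prod, map_list_prod, List.map_map, List.map_map] at h1
  exact h1

/-- The relator split at `g₀` and at `s`:
`(∏_{i<g₀}[a_i,b_i]) (∏_{g₀≤i}[a_i,b_i]) ((c_0⋯c_{s−1}) (c_s⋯c_{r−1})) = 1`.
[cite: MochizukiSemiAnbd2006, Ex. 2.10 p.31] -/
theorem comm_split_mul_cusp_split_eq_one (g₀ s : ℕ) :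
    ((List.finRange g).map fun i : Fin g => if (i : ℕ) < g₀ then
        a (r := r) i * b i * (a i)⁻¹ * (b i)⁻¹ else 1).prod *
      ((List.finRange g).map fun i : Fin g => if g₀ ≤ (i : ℕ) then
        a (r := r) i * b i * (a i)⁻¹ * (b i)⁻¹ else 1).prod *
      (((List.finRange r).map fun j : Fin r => if (j : ℕ) < s then c (g := g) j else 1).prod *
        ((List.finRange r).map fun j : Fin r => if s ≤ (j : ℕ) then c (g := g) j else 1).prod) = 1 := by
  rw [← prod_map_finRange_split, ← prod_map_finRange_split]
  exact comm_prod_mul_cusp_prod_eq_one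

/-- **The relation of the second component.**  With `ε = (c_s⋯c_{r−1}) · ∏_{i<g₀}[a_i,b_i]` (the node
loop seen from `C₀`): `(∏_{g₀≤i}[a_i,b_i]) · (c_0 ⋯ c_{s−1}) · ε = 1`, i.e. `ε⁻¹` is the node loop seen
from `C₁`. [cite: MochizukiSemiAnbd2006, Ex. 2.10 p.31] -/
theorem nodeLoop_rel (g₀ s : ℕ) (ε : PuncturedSurfaceGroup g r)
    (hε : ε = ((List.finRange r).map fun j : Fin r => if s ≤ (j : ℕ) then c (g := g) j else 1).prod *
      ((List.finRange g).map fun i : Fin g => if (i : ℕ) < g₀ then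
        a (r := r) i * b i * (a i)⁻¹ * (b i)⁻¹ else 1).prod) :
    ((List.finRange g).map fun i : Fin g => if g₀ ≤ (i : ℕ) then
        a (r := r) i * b i * (a i)⁻¹ * (b i)⁻¹ else 1).prod *
      ((List.finRange r).map fun j : Fin r => if (j : ℕ) < s then c (g := g) j else 1).prod * ε = 1 := by
  have h := comm_split_mul_cusp_split_eq_one (g := g) (r := r) g₀ s
  set X := ((List.finRange g).map fun i : Fin g => if (i : ℕ) < g₀ then
        a (r := r) i * b i * (a i)⁻¹ * (b i)⁻¹ else 1).prod
  set Y := ((List.finRange g).map fun i : Fin g => if g₀ ≤ (i : ℕ) then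
        a (r := r) i * b i * (a i)⁻¹ * (b i)⁻¹ else 1).prod
  set C' := ((List.finRange r).map fun j : Fin r => if (j : ℕ) < s then c (g := g) j else 1).prod
  set C'' := ((List.finRange r).map fun j : Fin r => if s ≤ (j : ℕ) then c (g := g) j else 1).prod
  rw [hε]
  calc Y * C' * (C'' * X) = X⁻¹ * (X * Y * (C' * C'')) * X := by group
    _ = 1 := by rw [h]; group

/-- `ε = c_s · ((c_{s+1}⋯c_{r−1}) ∏_{i<g₀}[a_i,b_i])` for `s < r`. [cite: MochizukiSemiAnbd2006, Ex. 2.10 p.31] -/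
theorem nodeLoop_eq_c_mul (g₀ s : ℕ) (hs : s < r) (ε : PuncturedSurfaceGroup g r)
    (hε : ε = ((List.finRange r).map fun j : Fin r => if s ≤ (j : ℕ) then c (g := g) j else 1).prod *
      ((List.finRange g).map fun i : Fin g => if (i : ℕ) < g₀ then
        a (r := r) i * b i * (a i)⁻¹ * (b i)⁻¹ else 1).prod) :
    ε = c ⟨s, hs⟩ * (((List.finRange r).map fun j : Fin r => if s + 1 ≤ (j : ℕ) then c (g := g) j else 1).prod *
      ((List.finRange g).map fun i : Fin g => if (i : ℕ) < g₀ then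
        a (r := r) i * b i * (a i)⁻¹ * (b i)⁻¹ else 1).prod) := by
  rw [hε, prod_map_finRange_ite_le_peel r s hs, mul_assoc]

/-- `c_0 ⋯ c_{s−1} = c_0 · (c_1 ⋯ c_{s−1})` for `0 < s`, `0 < r`. [cite: MochizukiSemiAnbd2006, Ex. 2.10 p.31] -/
theorem cusp_prod_lt_eq_c_zero_mul (s : ℕ) (hs : 0 < s) (hr : 0 < r) :
    ((List.finRange r).map fun j : Fin r => if (j : ℕ) < s then c (g := g) j else 1).prod =
      c ⟨0, hr⟩ * ((List.finRange r).map fun j : Fin r =>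
        if 1 ≤ (j : ℕ) ∧ (j : ℕ) < s then c (g := g) j else 1).prod := by
  classical
  rw [prod_map_finRange_split r 1 (fun j : Fin r => if (j : ℕ) < s then c (g := g) j else 1)]
  have e1 : (fun i : Fin r => if (i : ℕ) < 1 then (if (i : ℕ) < s then c (g := g) i else 1) else 1) =
      fun i : Fin r => if i = ⟨0, hr⟩ then c (g := g) i else 1 := by
    funext i
    by_cases h : i = ⟨0, hr⟩
    · subst h; simp [hs]
    · have h' : (i : ℕ) ≠ 0 := fun e => h (Fin.ext e)
      rw [if_neg h, if_neg (by omega)]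
  have e2 : (fun i : Fin r => if 1 ≤ (i : ℕ) then (if (i : ℕ) < s then c (g := g) i else 1) else 1) =
      fun i : Fin r => if 1 ≤ (i : ℕ) ∧ (i : ℕ) < s then c (g := g) i else 1 := by
    funext i
    by_cases h1 : 1 ≤ (i : ℕ)
    · by_cases h2 : (i : ℕ) < s
      · rw [if_pos h1, if_pos h2, if_pos ⟨h1, h2⟩]
      · rw [if_pos h1, if_neg h2, if_neg (fun h => h2 h.2)]
    · rw [if_neg h1, if_neg (fun h => h1 h.1)]
  rw [e1, e2, prod_map_finRange_ite_eq_single]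

/-! ### Free bases -/

/-- **The `c₀`-eliminating free basis of `Γ_{g,r+1}`**, packaged: a free basis `b₀` indexed by
`(Fin g × Bool) ⊕ Fin r` with `b₀(i,false) = a_i`, `b₀(i,true) = b_i`, `b₀(j) = c_{j+1}`.
[cite: MochizukiSemiAnbd2006, Ex. 2.10 p.31] -/
theorem exists_freeGroupBasis_elim_zero (g r : ℕ) :
    ∃ b₀ : FreeGroupBasis ((Fin g × Bool) ⊕ Fin r) (PuncturedSurfaceGroup g (r + 1)),
      (∀ i, b₀ (Sum.inl (i, false)) = a i) ∧ (∀ i, b₀ (Sum.inl (i, true)) = b i) ∧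
        ∀ j : Fin r, b₀ (Sum.inr j) = c (Fin.succ j) := by
  obtain ⟨e, hea, heb, hec⟩ := exists_mulEquiv_freeGroup_elim_first g r
  refine ⟨FreeGroupBasis.ofRepr e, fun i => ?_, fun i => ?_, fun j => ?_⟩
  · change e.symm (FreeGroup.of (Sum.inl (i, false))) = a i
    rw [← hea i, MulEquiv.symm_apply_apply]
  · change e.symm (FreeGroup.of (Sum.inl (i, true))) = b i
    rw [← heb i, MulEquiv.symm_apply_apply]
  · change e.symm (FreeGroup.of (Sum.inr j)) = c (Fin.succ j)
    rw [← hec j, MulEquiv.symm_apply_apply]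

/-- **The node-loop free basis of `Γ_{g,r+1}`.**  For `1 ≤ s ≤ r` and
`ε = (c_s⋯c_r) · ∏_{i<g₀}[a_i,b_i]` there is a free basis `b'` of `Γ_{g,r+1}`, indexed by
`(Fin g × Bool) ⊕ Fin r`, with `b'(i,false) = a_i`, `b'(i,true) = b_i`, `b'(j) = c_{j+1}` for `j + 1 ≠ s`
and `b'(s−1) = ε` (Nielsen move `c_s ↦ c_s · (c_{s+1}⋯c_r ∏_{i<g₀}[a_i,b_i])` on the `c₀`-eliminating
basis). [cite: MochizukiSemiAnbd2006, Ex. 2.10 p.31] -/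
theorem exists_freeGroupBasis_nodeLoop (g r g₀ s : ℕ) (hs1 : 1 ≤ s) (hsr : s ≤ r)
    (ε : PuncturedSurfaceGroup g (r + 1))
    (hε : ε = ((List.finRange (r + 1)).map fun j : Fin (r + 1) =>
        if s ≤ (j : ℕ) then c (g := g) j else 1).prod *
      ((List.finRange g).map fun i : Fin g => if (i : ℕ) < g₀ then
        a (r := r + 1) i * b i * (a i)⁻¹ * (b i)⁻¹ else 1).prod) :
    ∃ b' : FreeGroupBasis ((Fin g × Bool) ⊕ Fin r) (PuncturedSurfaceGroup g (r + 1)),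
      (∀ i, b' (Sum.inl (i, false)) = a i) ∧ (∀ i, b' (Sum.inl (i, true)) = b i) ∧
        (∀ j : Fin r, (j : ℕ) + 1 ≠ s → b' (Sum.inr j) = c (Fin.succ j)) ∧
          b' (Sum.inr ⟨s - 1, by omega⟩) = ε := by
  classical
  obtain ⟨b₀, ha, hb, hc⟩ := exists_freeGroupBasis_elim_zero g r
  set k : (Fin g × Bool) ⊕ Fin r := Sum.inr ⟨s - 1, by omega⟩ with hk
  have hsr' : s < r + 1 := by omega
  -- `u = (c_{s+1}⋯c_r) ∏_{i<g₀}[a_i,b_i]`, a word in the members `≠ k`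
  set u : PuncturedSurfaceGroup g (r + 1) :=
    ((List.finRange (r + 1)).map fun j : Fin (r + 1) => if s + 1 ≤ (j : ℕ) then c (g := g) j else 1).prod *
      ((List.finRange g).map fun i : Fin g => if (i : ℕ) < g₀ then
        a (r := r + 1) i * b i * (a i)⁻¹ * (b i)⁻¹ else 1).prod with hu
  have hck : b₀ k = c ⟨s, hsr'⟩ := by
    rw [hk, hc]
    congr 1
    ext
    simp only [Fin.val_succ]
    omega
  have hεu : ε = b₀ k * u := by rw [hck, hu]; exact nodeLoop_eq_c_mul g₀ s hsr' ε hε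
  have haK : ∀ i, a (r := r + 1) i ∈ Subgroup.closure (b₀ '' {j | j ≠ k}) := fun i =>
    Subgroup.subset_closure ⟨Sum.inl (i, false), by simp [hk], ha i⟩
  have hbK : ∀ i, b (r := r + 1) i ∈ Subgroup.closure (b₀ '' {j | j ≠ k}) := fun i =>
    Subgroup.subset_closure ⟨Sum.inl (i, true), by simp [hk], hb i⟩
  have hcK : ∀ j : Fin (r + 1), s + 1 ≤ (j : ℕ) → c (g := g) j ∈ Subgroup.closure (b₀ '' {j | j ≠ k}) := by
    intro j hj
    have hj0 : (j : ℕ) ≠ 0 := by omega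
    obtain ⟨j', hj'⟩ : ∃ j' : Fin r, Fin.succ j' = j := ⟨j.pred (fun h => hj0 (by rw [h]; rfl)), Fin.succ_pred _ _⟩
    refine Subgroup.subset_closure ⟨Sum.inr j', ?_, by rw [hc, hj']⟩
    simp only [Set.mem_setOf_eq, hk, Ne, Sum.inr.injEq]
    intro h
    have h1 : (j' : ℕ) = s - 1 := by rw [h]
    have h2 : (j : ℕ) = (j' : ℕ) + 1 := by rw [← hj', Fin.val_succ]
    omega
  have huK : u ∈ Subgroup.closure (b₀ '' {j | j ≠ k}) := by
    rw [hu]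
    refine Subgroup.mul_mem _ (prod_map_finRange_ite_mem _ _ _ _ hcK)
      (prod_map_finRange_ite_mem _ _ _ _ fun i _ => ?_)
    exact Subgroup.mul_mem _ (Subgroup.mul_mem _ (Subgroup.mul_mem _ (haK i) (hbK i))
      (Subgroup.inv_mem _ (haK i))) (Subgroup.inv_mem _ (hbK i))
  obtain ⟨b', hb'k, hb'⟩ := exists_freeGroupBasis_update_mul b₀ k u huK
  refine ⟨b', fun i => ?_, fun i => ?_, fun j hj => ?_, ?_⟩
  · rw [hb' _ (by simp [hk]), ha]
  · rw [hb' _ (by simp [hk]), hb]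
  · rw [hb' _ ?_, hc]
    simp only [hk, Ne, Sum.inr.injEq]
    intro h
    apply hj
    have h1 : (j : ℕ) = s - 1 := by rw [h]
    omega
  · rw [hb'k, hεu]

end PuncturedSurfaceGroup

end Literature.GroupTheory.CombinatorialGroupTheory
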